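import Mathlib
import HarnessLib
import Summits.HubbardSuperconductivity.HubbardSuperconductivity.Theorems.KLProgrammeKLRegimeVolumeLimitNestedCarrierSite
import Summits.HubbardSuperconductivity.HubbardSuperconductivity.Theorems.KLProgrammeKLRegimeVolumeLimitGenericClosure

/-!
# VL children, BUNDLE-GENERIC input doors for the one carrier export: the «cauchy» v3 `stub_vl_carrierRate` TEXT for any bundle `Pr` and window `W`
# from NESTED data (momentum form) or from POSITION-SPACE data (periodisation + first site moment)
# (cell gate-hubbard-kl, seat hubbard-kl-k3c5-p3 g5, technique «OS-positivity-free direct assembly»; `--supports` stmt-…-19921)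

`…VolumeLimitNestedCarrierRate.stub_vl_carrierRate_of_nested` and `…NestedCarrierSite.stub_vl_carrierRate_of_sitePeriodisation` conclude the gen-5 text
(prefix tokens `klPredsV14`, `klWindowC`).  Their proofs never read the prefix, so here they are stated ONCE for every `Pr : Preds` and `W : Set ℝ`
(`carrierRateText_of_nested`, `carrierRateText_of_sitePeriodisation`); together with `volumeLimitP2_of_carrierTexts` (`…VolumeLimitGenericClosure`) a re-typed
VL child of a later generation closes from nested / position-space engine exports with no new door file.  Everything is proved; no definition; nothing
is asserted about the model.
-/

noncomputable section

namespace Summit.HubbardSuperconductivity.HubbardSuperconductivity.Theorems.TwoPointAssembly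

set_option linter.dupNamespace false -- summit = problem name (single-conjunct summit), D-0017

open Finset Filter Topology Literature.MathematicalPhysics.QuantumLattice Literature.Probability.LatticeModels
open Literature.MathematicalPhysics.QuantumLattice.FermiRG
open Summit.HubbardSuperconductivity.HubbardSuperconductivity.Theorems.DispersionFlow
open Summit.HubbardSuperconductivity.HubbardSuperconductivity.Theorems.KLRegimeSplit
open Summit.HubbardSuperconductivity.HubbardSuperconductivity.Theorems.KLProgrammeLegKernels

/-- **The carrier-export text of a VL child (any bundle `Pr`, window `W`) FROM NESTED DATA**: nested same-momentum comparability (N) + a one-volume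
momentum modulus (M) of the bare last-scale self-energy ⇒ the arbitrary-pair same-cutoff rate with cross-grid modulus. -/
theorem carrierRateText_of_nested (Pr : Preds) (W : Set ℝ)
    (hN : ∀ (G : GeoConsts) (P : SplitConsts) (Q : EngConsts) (R : RenConsts), G.WF → P.WF → Q.WF → R.WF →
      ∃ c₅ : ℝ, 0 < c₅ ∧ ∀ c : ℝ, 0 < c → c ≤ c₅ → ∃ U₀ : ℝ, 0 < U₀ ∧
        ∀ μ ∈ W, ∀ U : ℝ, 0 < U → U ≤ U₀ → ∀ β : ℝ, klBetaMin ≤ β → β ≤ Real.exp (c / U ^ 2) →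
          ∀ K : TrigPolyC4v, Pr.frameOK R U (nScales β) μ K →
            ∀ (Lstar : ℕ) (Mstar : ℕ → ℕ), TowerP Pr G P Q R β U μ K Lstar Mstar →
              ∃ L₀ : ℕ, ∃ ρ : ℕ → ℝ, Tendsto ρ atTop (𝓝 0) ∧
                ∀ (L : ℕ) [NeZero L], L₀ ≤ L → ∀ (L'' : ℕ) [NeZero L''], L ∣ L'' → ∃ M₀ : ℕ, ∀ (M : ℕ) [NeZero M], M₀ ≤ M →
                  ∀ (ω : MatsubaraIdx M) (k : TorusSite 2 L) (k'' : TorusSite 2 L''), latticeMomentum L'' k'' = latticeMomentum L k →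
                    ‖klSelfEnergy L M β U μ 0 klE0 (nScales β + 1) (ω, k) 0 -
                        klSelfEnergy L'' M β U μ 0 klE0 (nScales β + 1) (ω, k'') 0‖ ≤ ρ L)
    (hM : ∀ (G : GeoConsts) (P : SplitConsts) (Q : EngConsts) (R : RenConsts), G.WF → P.WF → Q.WF → R.WF →
      ∃ c₅ : ℝ, 0 < c₅ ∧ ∀ c : ℝ, 0 < c → c ≤ c₅ → ∃ U₀ : ℝ, 0 < U₀ ∧
        ∀ μ ∈ W, ∀ U : ℝ, 0 < U → U ≤ U₀ → ∀ β : ℝ, klBetaMin ≤ β → β ≤ Real.exp (c / U ^ 2) →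
          ∀ K : TrigPolyC4v, Pr.frameOK R U (nScales β) μ K →
            ∀ (Lstar : ℕ) (Mstar : ℕ → ℕ), TowerP Pr G P Q R β U μ K Lstar Mstar →
              ∃ L₀ : ℕ, ∃ D : ℝ, ∃ ρ' : ℕ → ℝ, Tendsto ρ' atTop (𝓝 0) ∧
                ∀ (L : ℕ) [NeZero L], L₀ ≤ L → ∃ M₀ : ℕ, ∀ (M : ℕ) [NeZero M], M₀ ≤ M →
                  ∀ (ω : MatsubaraIdx M) (k₁ k₂ : TorusSite 2 L),
                    ‖klSelfEnergy L M β U μ 0 klE0 (nScales β + 1) (ω, k₁) 0 -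
                        klSelfEnergy L M β U μ 0 klE0 (nScales β + 1) (ω, k₂) 0‖ ≤
                      ρ' L + D * ∑ i, torusAbs (latticeMomentum L k₁ i - latticeMomentum L k₂ i)) :
    ∀ (G : GeoConsts) (P : SplitConsts) (Q : EngConsts) (R : RenConsts), G.WF → P.WF → Q.WF → R.WF →
      ∃ c₅ : ℝ, 0 < c₅ ∧ ∀ c : ℝ, 0 < c → c ≤ c₅ → ∃ U₀ : ℝ, 0 < U₀ ∧
        ∀ μ ∈ W, ∀ U : ℝ, 0 < U → U ≤ U₀ → ∀ β : ℝ, klBetaMin ≤ β → β ≤ Real.exp (c / U ^ 2) →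
          ∀ K : TrigPolyC4v, Pr.frameOK R U (nScales β) μ K →
            ∀ (Lstar : ℕ) (Mstar : ℕ → ℕ), TowerP Pr G P Q R β U μ K Lstar Mstar →
              ∃ L₀ : ℕ, ∃ D : ℝ, ∃ ρ : ℕ → ℝ, Tendsto ρ atTop (𝓝 0) ∧
                ∀ (L : ℕ) [NeZero L], L₀ ≤ L → ∀ (L' : ℕ) [NeZero L'], L ≤ L' → ∃ M₀ : ℕ, ∀ (M : ℕ) [NeZero M], M₀ ≤ M →
                  ∀ (ω : MatsubaraIdx M) (k : TorusSite 2 L) (k' : TorusSite 2 L'),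
                    ‖klSelfEnergy L M β U μ 0 klE0 (nScales β + 1) (ω, k) 0 -
                        klSelfEnergy L' M β U μ 0 klE0 (nScales β + 1) (ω, k') 0‖ ≤
                      ρ L + D * ∑ i, torusAbs (latticeMomentum L k i - latticeMomentum L' k' i) := by
  intro G P Q R hG hP hQ hR
  obtain ⟨c₁, hc₁, h₁⟩ := hN G P Q R hG hP hQ hR
  obtain ⟨c₂, hc₂, h₂⟩ := hM G P Q R hG hP hQ hR
  refine ⟨min c₁ c₂, lt_min hc₁ hc₂, fun c hc hcle => ?_⟩
  obtain ⟨U₁, hU₁, h₁'⟩ := h₁ c hc (hcle.trans (min_le_left _ _))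
  obtain ⟨U₂, hU₂, h₂'⟩ := h₂ c hc (hcle.trans (min_le_right _ _))
  refine ⟨min U₁ U₂, lt_min hU₁ hU₂, ?_⟩
  intro μ hμ U hU hUle β hβ hβle K hK Lstar Mstar hT
  obtain ⟨L₁, ρ, hρ, hnest⟩ := h₁' μ hμ U hU (hUle.trans (min_le_left _ _)) β hβ hβle K hK Lstar Mstar hT
  obtain ⟨L₂, D, ρ', hρ', hmod⟩ := h₂' μ hμ U hU (hUle.trans (min_le_right _ _)) β hβ hβle K hK Lstar Mstar hT
  obtain ⟨ρ₂, hρ₂, hrate⟩ := twoVolumeRate_of_nestedRate_cutoff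
    (T := fun L M _ _ ω k => klSelfEnergy L M β U μ 0 klE0 (nScales β + 1) (ω, k) 0) (L₀ := max L₁ L₂) (D := D) hρ hρ'
    (fun L _ hL L'' _ hdvd => hnest L (le_of_max_le_left hL) L'' hdvd) (fun L _ hL => hmod L (le_of_max_le_right hL))
  exact ⟨max L₁ L₂, D, ρ₂, hρ₂, fun L _ hL L' _ hLL' => hrate L hL L' hLL'⟩


/-- **The carrier-export text of a VL child (any bundle `Pr`, window `W`) FROM POSITION-SPACE DATA**: (S) `ℓ¹` comparability of the site kernel
`torusFourierInv (Σ̂⁰_{L,M}(ω,·))` with the periodised site kernel of the nested volume `b·L`, (D) an `L`-uniform first centred site moment. -/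
theorem carrierRateText_of_sitePeriodisation (Pr : Preds) (W : Set ℝ)
    (hS : ∀ (G : GeoConsts) (P : SplitConsts) (Q : EngConsts) (R : RenConsts), G.WF → P.WF → Q.WF → R.WF →
      ∃ c₅ : ℝ, 0 < c₅ ∧ ∀ c : ℝ, 0 < c → c ≤ c₅ → ∃ U₀ : ℝ, 0 < U₀ ∧
        ∀ μ ∈ W, ∀ U : ℝ, 0 < U → U ≤ U₀ → ∀ β : ℝ, klBetaMin ≤ β → β ≤ Real.exp (c / U ^ 2) →
          ∀ K : TrigPolyC4v, Pr.frameOK R U (nScales β) μ K →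
            ∀ (Lstar : ℕ) (Mstar : ℕ → ℕ), TowerP Pr G P Q R β U μ K Lstar Mstar →
              ∃ L₀ : ℕ, ∃ ρ : ℕ → ℝ, Tendsto ρ atTop (𝓝 0) ∧
                ∀ (L : ℕ) [NeZero L], L₀ ≤ L → ∀ (L'' : ℕ) [NeZero L''] (b : ℕ), L'' = b * L → ∃ M₀ : ℕ, ∀ (M : ℕ) [NeZero M], M₀ ≤ M →
                  ∀ ω : MatsubaraIdx M,
                    ∑ y : TorusSite 2 L,
                      ‖torusFourierInv (fun k : TorusSite 2 L => klSelfEnergy L M β U μ 0 klE0 (nScales β + 1) (ω, k) 0) y -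
                        ∑ x ∈ Finset.univ.filter (fun x : TorusSite 2 L'' => (fun i => (((x i).val : ℕ) : ZMod L)) = y),
                          torusFourierInv (fun k : TorusSite 2 L'' => klSelfEnergy L'' M β U μ 0 klE0 (nScales β + 1) (ω, k) 0) x‖ ≤ ρ L)
    (hD : ∀ (G : GeoConsts) (P : SplitConsts) (Q : EngConsts) (R : RenConsts), G.WF → P.WF → Q.WF → R.WF →
      ∃ c₅ : ℝ, 0 < c₅ ∧ ∀ c : ℝ, 0 < c → c ≤ c₅ → ∃ U₀ : ℝ, 0 < U₀ ∧
        ∀ μ ∈ W, ∀ U : ℝ, 0 < U → U ≤ U₀ → ∀ β : ℝ, klBetaMin ≤ β → β ≤ Real.exp (c / U ^ 2) →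
          ∀ K : TrigPolyC4v, Pr.frameOK R U (nScales β) μ K →
            ∀ (Lstar : ℕ) (Mstar : ℕ → ℕ), TowerP Pr G P Q R β U μ K Lstar Mstar →
              ∃ L₀ : ℕ, ∃ D : ℝ, ∀ (L : ℕ) [NeZero L], L₀ ≤ L → ∃ M₀ : ℕ, ∀ (M : ℕ) [NeZero M], M₀ ≤ M → ∀ ω : MatsubaraIdx M,
                ∑ z : TorusSite 2 L, (∑ i, |(Torus.cRepZ (z i) : ℝ)|) *
                  ‖torusFourierInv (fun k : TorusSite 2 L => klSelfEnergy L M β U μ 0 klE0 (nScales β + 1) (ω, k) 0) z‖ ≤ D) :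
    ∀ (G : GeoConsts) (P : SplitConsts) (Q : EngConsts) (R : RenConsts), G.WF → P.WF → Q.WF → R.WF →
      ∃ c₅ : ℝ, 0 < c₅ ∧ ∀ c : ℝ, 0 < c → c ≤ c₅ → ∃ U₀ : ℝ, 0 < U₀ ∧
        ∀ μ ∈ W, ∀ U : ℝ, 0 < U → U ≤ U₀ → ∀ β : ℝ, klBetaMin ≤ β → β ≤ Real.exp (c / U ^ 2) →
          ∀ K : TrigPolyC4v, Pr.frameOK R U (nScales β) μ K →
            ∀ (Lstar : ℕ) (Mstar : ℕ → ℕ), TowerP Pr G P Q R β U μ K Lstar Mstar →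
              ∃ L₀ : ℕ, ∃ D : ℝ, ∃ ρ : ℕ → ℝ, Tendsto ρ atTop (𝓝 0) ∧
                ∀ (L : ℕ) [NeZero L], L₀ ≤ L → ∀ (L' : ℕ) [NeZero L'], L ≤ L' → ∃ M₀ : ℕ, ∀ (M : ℕ) [NeZero M], M₀ ≤ M →
                  ∀ (ω : MatsubaraIdx M) (k : TorusSite 2 L) (k' : TorusSite 2 L'),
                    ‖klSelfEnergy L M β U μ 0 klE0 (nScales β + 1) (ω, k) 0 -
                        klSelfEnergy L' M β U μ 0 klE0 (nScales β + 1) (ω, k') 0‖ ≤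
                      ρ L + D * ∑ i, torusAbs (latticeMomentum L k i - latticeMomentum L' k' i) := by
  refine carrierRateText_of_nested Pr W ?_ ?_
  · -- (N) from (S): Poisson on nested tori
    intro G P Q R hG hP hQ hR
    obtain ⟨c₅, hc₅, hc⟩ := hS G P Q R hG hP hQ hR
    refine ⟨c₅, hc₅, fun c hc0 hcc => ?_⟩
    obtain ⟨U₀, hU₀, hU⟩ := hc c hc0 hcc
    refine ⟨U₀, hU₀, fun μ hμ U hU0 hUU β hβmin hβmax K hK Lstar Mstar hT => ?_⟩
    obtain ⟨L₀, ρ, hρ, hper⟩ := hU μ hμ U hU0 hUU β hβmin hβmax K hK Lstar Mstar hT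
    refine ⟨L₀, ρ, hρ, fun L _ hL L'' _ hdvd => ?_⟩
    obtain ⟨b, hb⟩ := hdvd
    have hM : L'' = b * L := hb.trans (mul_comm _ _)
    obtain ⟨M₀, hM₀⟩ := hper L hL L'' b hM
    refine ⟨M₀, fun M _ hMM ω k k'' hkk => ?_⟩
    rw [eq_torusFourier_torusFourierInv (fun k : TorusSite 2 L => klSelfEnergy L M β U μ 0 klE0 (nScales β + 1) (ω, k) 0) k,
      eq_torusFourier_torusFourierInv (fun k : TorusSite 2 L'' => klSelfEnergy L'' M β U μ 0 klE0 (nScales β + 1) (ω, k) 0) k'']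
    exact (norm_torusFourier_sub_torusFourier_of_latticeMomentum_eq hM _ _ hkk).trans (hM₀ M hMM ω)
  · -- (M) from (D): the first centred site moment (no slack)
    intro G P Q R hG hP hQ hR
    obtain ⟨c₅, hc₅, hc⟩ := hD G P Q R hG hP hQ hR
    refine ⟨c₅, hc₅, fun c hc0 hcc => ?_⟩
    obtain ⟨U₀, hU₀, hU⟩ := hc c hc0 hcc
    refine ⟨U₀, hU₀, fun μ hμ U hU0 hUU β hβmin hβmax K hK Lstar Mstar hT => ?_⟩
    obtain ⟨L₀, D, hmom⟩ := hU μ hμ U hU0 hUU β hβmin hβmax K hK Lstar Mstar hT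
    refine ⟨L₀, D, fun _ => 0, tendsto_const_nhds, fun L _ hL => ?_⟩
    obtain ⟨M₀, hM₀⟩ := hmom L hL
    refine ⟨M₀, fun M _ hMM ω k₁ k₂ => ?_⟩
    rw [zero_add, eq_torusFourier_torusFourierInv (fun k : TorusSite 2 L => klSelfEnergy L M β U μ 0 klE0 (nScales β + 1) (ω, k) 0) k₁,
      eq_torusFourier_torusFourierInv (fun k : TorusSite 2 L => klSelfEnergy L M β U μ 0 klE0 (nScales β + 1) (ω, k) 0) k₂]
    refine (norm_torusFourier_sub_torusFourier_le_firstMoment _ k₁ k₂).trans ?_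
    exact mul_le_mul_of_nonneg_right (hM₀ M hMM ω) (klvc_tmod_nonneg _ _)

end Summit.HubbardSuperconductivity.HubbardSuperconductivity.Theorems.TwoPointAssembly

end
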